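import Literature.NumberTheory.GaloisRepresentations.LocalDualityTheorem
import Literature.NumberTheory.GaloisRepresentations.LocalTatePairing
import HarnessLib

/-!
# Local Tate duality (Milne, *ADT*, I Cor. 2.3, `r = 1`): discharge of
# `exists_perfectPairing_galoisCohomology_tateDual`

`exists_perfectPairing_galoisCohomology_tateDual_holds`: for a number field `K`, a finite discrete
`Γ_K`-module `M` killed by `n ≠ 0` and a finite place `v`, there is a perfect bi-additive pairing
`H¹(K_v, M) × H¹(K_v, M^∨(1)) → ℤ/n`, namely `(x, y) ↦ ι(x ∪ y)` for an injective
`ι : H²(K_v, μ_n) → ℤ/n` (`localDuality_bijective` for the local field `F = K_v`, transported from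
the `Γ_F`-modules `μ_n(F̄)`, `Hom(M, μ_n(F̄))` to the localisations `μ_n(K̄)|_{Γ_F}`,
`M^∨(1)|_{Γ_F}` of the tree along the chosen embedding `K̄ → F̄` (`muTransfer`, `muLocalIso`,
`tateDualLocalIso`), and the reduction `exists_perfectPairing_galoisCohomology_tateDual_of_cupProduct`).

## References
* J. S. Milne, *Arithmetic Duality Theorems*, 2nd ed., 2006, Ch. I, Cor. 2.3. [MilneADT2006]
* J.-P. Serre, *Galois Cohomology*, Springer, 1997, II §5.2 Thm. 2. [SerreGaloisCohomology1997]
-/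

noncomputable section

open CategoryTheory Function Field
open NumberField IsDedekindDomain

universe u

namespace Literature.NumberTheory.GaloisRepresentations

open _root_.TopRep _root_.ContRepresentation _root_.ContinuousCohomology DiscreteGaloisModule

/-! ### `μ_n(K̄) → μ_n(L̄)` along the chosen embedding `K̄ → L̄` -/

section MuTransfer

variable (K L : Type u) [Field K] [Field L] [Algebra K L] (n : ℕ)

/-- A root of unity of `K̄` as a root of unity of `L̄` (through `absClosureEmbedding K L`). [folklore] -/
def muTransfer : MuCarrier K n →+ MuCarrier L n where
  toFun v := muOfUnit L n (Units.map (absClosureEmbedding K L : AlgebraicClosure K →* AlgebraicClosure L) (muVal K n v))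
    (by rw [← map_pow, muVal_pow_eq_one, map_one])
  map_zero' := muVal_injective L n (by rw [muVal_muOfUnit, muVal_zero, muVal_zero, map_one])
  map_add' v w := muVal_injective L n (by rw [muVal_muOfUnit, muVal_add, muVal_add, muVal_muOfUnit, muVal_muOfUnit, map_mul])

/-- `muVal (muTransfer v) = ι (muVal v)`. [folklore] -/
@[simp] theorem muVal_muTransfer (v : MuCarrier K n) :
    muVal L n (muTransfer K L n v) =
      Units.map (absClosureEmbedding K L : AlgebraicClosure K →* AlgebraicClosure L) (muVal K n v) := rfl

/-- `muTransfer` is injective. [folklore] -/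
theorem muTransfer_injective : Injective (muTransfer K L n) := fun v w h => by
  apply muVal_injective K n
  have h' := congrArg (fun x => ((muVal L n x : (AlgebraicClosure L)ˣ) : AlgebraicClosure L)) h
  simp only [muVal_muTransfer, Units.coe_map, MonoidHom.coe_coe] at h'
  exact Units.ext ((absClosureEmbedding K L).injective h')

/-- **`muTransfer` is `Γ_L`-equivariant** (`Γ_L` acting on `μ_n(K̄)` through `Γ_L → Γ_K`):
`ι(res σ • ζ) = σ • ι ζ`. [folklore] -/
theorem muTransfer_mu (σ : absoluteGaloisGroup L) (v : MuCarrier K n) :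
    muTransfer K L n (mu K n (absGaloisRestrict K L σ) v) = mu L n σ (muTransfer K L n v) := by
  apply muVal_injective L n
  apply Units.ext
  rw [muVal_muTransfer, muVal_apply, muVal_apply, muVal_muTransfer, Units.coe_map, MonoidHom.coe_coe,
    Units.coe_smul, absGaloisRestrict_apply_smul, Units.coe_smul, Units.coe_map, MonoidHom.coe_coe]

variable [CharZero K] [CharZero L] [NeZero n]

omit [Algebra K L] [CharZero L] in
/-- `|μ_n(K̄)| = n`. [folklore] -/
theorem natCard_muCarrier : Nat.card (MuCarrier K n) = n := by
  haveI : NeZero (n : K) := ⟨Nat.cast_ne_zero.2 (NeZero.ne n)⟩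
  change Nat.card (rootsOfUnity n (AlgebraicClosure K)) = n
  exact HasEnoughRootsOfUnity.natCard_rootsOfUnity _ n

/-- `muTransfer` is bijective (both groups have order `n`). [folklore] -/
theorem muTransfer_bijective : Bijective (muTransfer K L n) := by
  haveI : Finite (MuCarrier K n) := Nat.finite_of_card_ne_zero (by rw [natCard_muCarrier]; exact NeZero.ne n)
  haveI : Finite (MuCarrier L n) := Nat.finite_of_card_ne_zero (by rw [natCard_muCarrier]; exact NeZero.ne n)
  exact (muTransfer_injective K L n).bijective_of_nat_card_le
    (by rw [natCard_muCarrier, natCard_muCarrier])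

/-- `muTransfer` as an additive equivalence. [folklore] -/
def muTransferEquiv : MuCarrier K n ≃+ MuCarrier L n :=
  AddEquiv.ofBijective (muTransfer K L n) (muTransfer_bijective K L n)

/-- Unfolding `muTransferEquiv`. [folklore] -/
@[simp] theorem muTransferEquiv_apply (v : MuCarrier K n) : muTransferEquiv K L n v = muTransfer K L n v := rfl

end MuTransfer

/-! ### The local isomorphisms at a finite place -/

section Place

variable {K : Type u} [Field K] [NumberField K] (v : HeightOneSpectrum (𝓞 K))
variable {M : Type u} [AddCommGroup M] [TopologicalSpace M] [DiscreteTopology M] [Finite M]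

attribute [local instance] absoluteGaloisGroup_compactSpace

attribute [local instance] charZero_adicCompletion

/-- **`μ_n(K̄)|_{Γ_{K_v}} ≅ μ_n(K̄_v)`** as discrete `Γ_{K_v}`-modules (all objects over the Mathlib
field `K_v = v.adicCompletion K`; the tree's `(mu K n).toLocal (Sum.inr v)` is definitionally the
source). [folklore] -/
def muLocalIso (n : ℕ) [NeZero n] :
    ((mu K n).restrict (absGaloisRestrict K (v.adicCompletion K))).toTopRep ≅ (mu (v.adicCompletion K) n).toTopRep :=
  topRepIsoOfEquiv (X := ((mu K n).restrict (absGaloisRestrict K (v.adicCompletion K))).toTopRep)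
    (Y := (mu (v.adicCompletion K) n).toTopRep)
    { (muTransferEquiv K (v.adicCompletion K) n).toIntLinearEquiv with
      continuous_toFun := continuous_of_discreteTopology
      continuous_invFun := continuous_of_discreteTopology }
    fun σ x => muTransfer_mu K (v.adicCompletion K) n σ x

/-- A Tate-dual element `f : M → μ_n(K̄)` followed by `μ_n(K̄) → μ_n(K̄_v)`. [folklore] -/
def tateDualTransfer (n : ℕ) (f : TateDual K M n) : HomCarrier M (MuCarrier (v.adicCompletion K) n) :=
  HomCarrier.ofAddMonoidHom ((muTransfer K (v.adicCompletion K) n).comp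
    { toFun := fun m => (f m : MuCarrier K n)
      map_zero' := map_zero f
      map_add' := map_add f })

omit [TopologicalSpace M] [DiscreteTopology M] [Finite M] in
/-- Unfolding `tateDualTransfer`. [folklore] -/
@[simp] theorem tateDualTransfer_apply (n : ℕ) (f : TateDual K M n) (m : M) :
    tateDualTransfer v n f m = muTransfer K (v.adicCompletion K) n (f m) := rfl

/-- `TateDual K M n ≃ Hom(M, μ_n(K̄_v))` (post-composition with `μ_n(K̄) ≃ μ_n(K̄_v)`). [folklore] -/
def tateDualTransferEquiv (n : ℕ) [NeZero n] : TateDual K M n ≃+ HomCarrier M (MuCarrier (v.adicCompletion K) n) where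
  toFun := tateDualTransfer v n
  invFun g :=
    { toFun := fun m => (muTransferEquiv K (v.adicCompletion K) n).symm (g m)
      map_zero' := by simp only [map_zero]; rfl
      map_add' := fun m m' => by simp only [map_add]; rfl }
  left_inv f := by
    refine DFunLike.ext _ _ fun m => ?_
    exact (muTransferEquiv K (v.adicCompletion K) n).symm_apply_apply (f m)
  right_inv g := HomCarrier.ext fun m => by
    rw [tateDualTransfer_apply]
    exact (muTransferEquiv K (v.adicCompletion K) n).apply_symm_apply (g m)
  map_add' f f' := HomCarrier.ext fun m => by
    rw [HomCarrier.add_apply, tateDualTransfer_apply, tateDualTransfer_apply, tateDualTransfer_apply, ← map_add]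
    rfl

/-- **`M^∨(1)|_{Γ_{K_v}} ≅ Hom(M|_{Γ_{K_v}}, μ_n(K̄_v))`** as discrete `Γ_{K_v}`-modules. [folklore] -/
def tateDualLocalIso (ρ : DiscreteGaloisModule K M) (n : ℕ) [NeZero n] :
    ((ρ.tateDual n).restrict (absGaloisRestrict K (v.adicCompletion K))).toTopRep ≅
      ((ρ.restrict (absGaloisRestrict K (v.adicCompletion K))).homRep (mu (v.adicCompletion K) n)).toTopRep :=
  topRepIsoOfEquiv (X := ((ρ.tateDual n).restrict (absGaloisRestrict K (v.adicCompletion K))).toTopRep)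
    (Y := ((ρ.restrict (absGaloisRestrict K (v.adicCompletion K))).homRep (mu (v.adicCompletion K) n)).toTopRep)
    { (tateDualTransferEquiv v n (M := M)).toIntLinearEquiv with
      continuous_toFun := continuous_of_discreteTopology
      continuous_invFun := continuous_of_discreteTopology }
    fun σ f => HomCarrier.ext fun m => by
      change tateDualTransfer v n ((ρ.tateDual n) (absGaloisRestrict K (v.adicCompletion K) σ) f) m =
        (((ρ.restrict (absGaloisRestrict K (v.adicCompletion K))).homRep (mu (v.adicCompletion K) n)) σ
          (tateDualTransfer v n f)) m
      rw [tateDualTransfer_apply, ContinuousRep.homRep_apply_apply_apply, tateDualTransfer_apply,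
        ContinuousRep.restrict_apply, map_inv, ← muTransfer_mu]
      rfl

/-- The local evaluation pairing over `K_v` (definitionally the tree's `tateDualPairingLocal ρ n (Sum.inr v)`).
[folklore] -/
def localPairingF (ρ : DiscreteGaloisModule K M) (n : ℕ) :
    ContPairing (ρ.restrict (absGaloisRestrict K (v.adicCompletion K))).toTopRep
      ((ρ.tateDual n).restrict (absGaloisRestrict K (v.adicCompletion K))).toTopRep
      ((mu K n).restrict (absGaloisRestrict K (v.adicCompletion K))).toTopRep :=
  pairing (ρ.restrict (absGaloisRestrict K (v.adicCompletion K)))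
    ((ρ.tateDual n).restrict (absGaloisRestrict K (v.adicCompletion K)))
    ((mu K n).restrict (absGaloisRestrict K (v.adicCompletion K))) (tateDualEval K M n)
    fun _ m f => tateDualEval_smul ρ n _ m f

/-- **`ι(H²(e_μ)(x ∪ y)) = ⟨x, H¹(e_D) y⟩`**: the tree's local Tate pairing is the duality pairing of
`LocalDualityTheorem` transported along `muLocalIso`, `tateDualLocalIso`. [folklore] -/
theorem iota_cupProduct_localPairingF (ρ : DiscreteGaloisModule K M) (n : ℕ) [NeZero n]
    (ι : continuousCohomology 2 (mu (v.adicCompletion K) n).toTopRep →+ ZMod n)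
    (x : continuousCohomology 1 (ρ.restrict (absGaloisRestrict K (v.adicCompletion K))).toTopRep)
    (y : continuousCohomology 1 ((ρ.tateDual n).restrict (absGaloisRestrict K (v.adicCompletion K))).toTopRep) :
    ι (cohomologyMap (muLocalIso v n).hom 2 ((localPairingF v ρ n).cupProduct x y)) =
      (ρ.restrict (absGaloisRestrict K (v.adicCompletion K))).dualityPairing (mu (v.adicCompletion K) n) ι x
        (cohomologyMap (tateDualLocalIso v ρ n).hom 1 y) := by
  rw [ContinuousRep.dualityPairing_apply,
    ContPairing.cupProduct_map (localPairingF v ρ n)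
      ((ρ.restrict (absGaloisRestrict K (v.adicCompletion K))).evalPairing (mu (v.adicCompletion K) n)) (𝟙 _)
      (tateDualLocalIso v ρ n).hom (muLocalIso v n).hom (fun _ _ => rfl) x y,
    show cohomologyMap (𝟙 (ρ.restrict (absGaloisRestrict K (v.adicCompletion K))).toTopRep) 1 x = x from
      map_apply_of_id _ (fun _ => rfl) _ (fun _ => rfl) 1 x]

set_option maxHeartbeats 1600000 in
/-- **Both adjoints of the local Tate pairing `(x, y) ↦ ι(x ∪ y)` are injective** for the
transported `ι`.  (The identifications of the tree's `K_v`-objects, typed over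
`NumberField.Place.Completion (Sum.inr v)`, with the same objects over Mathlib's `v.adicCompletion K`
are definitional but not syntactic, whence the raised heartbeat limit.) [cite: MilneADT2006, Ch. I, Cor. 2.3] -/
theorem localTatePairingZMod_injective (ρ : DiscreteGaloisModule K M) (n : ℕ) [NeZero n]
    (hM : ∀ m : M, n • m = 0) :
    ∃ inv : galoisCohomology ((mu K n).toLocal (Sum.inr v)) 2 →+ ZMod n,
      Injective (DiscreteGaloisModule.localTatePairingZMod ρ n (Sum.inr v) inv) ∧
      Injective (DiscreteGaloisModule.localTatePairingZMod ρ n (Sum.inr v) inv).flip := by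
  obtain ⟨ι, -, hb, hbf⟩ := localDuality_bijective (v.adicCompletion K)
    (ρ.restrict (absGaloisRestrict K (v.adicCompletion K))) hM
  let T := continuousCohomologyEquivOfIso (tateDualLocalIso v ρ n) 1
  let inv : continuousCohomology 2 ((mu K n).restrict (absGaloisRestrict K (v.adicCompletion K))).toTopRep →+ ZMod n :=
    ι.comp (cohomologyMap (muLocalIso v n).hom 2).hom.toLinearMap.toAddMonoidHom
  have hL : ∀ (x : continuousCohomology 1 (ρ.restrict (absGaloisRestrict K (v.adicCompletion K))).toTopRep)
      (y : continuousCohomology 1 ((ρ.tateDual n).restrict (absGaloisRestrict K (v.adicCompletion K))).toTopRep),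
      DiscreteGaloisModule.localTatePairingZMod ρ n (Sum.inr v) inv x y =
        (ρ.restrict (absGaloisRestrict K (v.adicCompletion K))).dualityPairing (mu (v.adicCompletion K) n) ι x (T y) :=
    fun x y => iota_cupProduct_localPairingF v ρ n ι x y
  refine ⟨inv, ?_, ?_⟩
  · refine (injective_iff_map_eq_zero _).2 fun x hx => hb.1 (a₂ := 0) ?_
    rw [map_zero]
    refine AddMonoidHom.ext fun y' => ?_
    obtain ⟨y, rfl⟩ := T.surjective y'
    rw [AddMonoidHom.zero_apply, ← hL]
    exact DFunLike.congr_fun hx y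
  · intro y₁ y₂ h
    obtain ⟨y₁, rfl⟩ : ∃ y : continuousCohomology 1
        ((ρ.tateDual n).restrict (absGaloisRestrict K (v.adicCompletion K))).toTopRep, y = y₁ := ⟨y₁, rfl⟩
    obtain ⟨y₂, rfl⟩ : ∃ y : continuousCohomology 1
        ((ρ.tateDual n).restrict (absGaloisRestrict K (v.adicCompletion K))).toTopRep, y = y₂ := ⟨y₂, rfl⟩
    refine T.injective (hbf.1 ?_)
    refine AddMonoidHom.ext fun x => ?_
    rw [AddMonoidHom.flip_apply, AddMonoidHom.flip_apply, ← hL, ← hL]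
    exact DFunLike.congr_fun h x

end Place

/-! ### The named fact -/

section Holds

variable {K : Type u} [Field K] [NumberField K] {M : Type u} [AddCommGroup M] [TopologicalSpace M]
  [DiscreteTopology M]

/-- **Local Tate duality** (Milne, *Arithmetic Duality Theorems*, I Cor. 2.3, degree `r = 1`):
discharge of `exists_perfectPairing_galoisCohomology_tateDual`. [cite: MilneADT2006, Ch. I, Cor. 2.3] -/
theorem exists_perfectPairing_galoisCohomology_tateDual_holds :
    exists_perfectPairing_galoisCohomology_tateDual (K := K) (M := M) :=
  exists_perfectPairing_galoisCohomology_tateDual_of_cupProduct fun ρ n _ hM v =>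
    localTatePairingZMod_injective v ρ n hM

end Holds

end Literature.NumberTheory.GaloisRepresentations

end
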